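import Mathlib

/-!
# T5PropGArithmetic — the elementary arithmetic of route-3's §G «Proposition G» (route/T5-CHECK-G-p7.md §7)

Kernel-checked glue of the chain S0–S8 of route-3's §G (the printed replacement for the
L-value half of [G-N5.1]: Hsieh 2014 Thm 1 + Burungale–Hida 2017 Thm B + Weierstrass +
the Katz–Hida–Tilouine interpolation formula) and of route-3's §H.1–H.2, in the shape of
statements about finite sums, torsion-free groups, roots of unity, polynomials and
infima. Nothing about L-functions, measures, Galois groups or modular forms is asserted:
each lemma is the arithmetic step that the prose invokes in one line, isolated.

* `parity_reindex` — S3: the two parity signs `(-1)^{Σ_σ κ_σ}` and `(-1)^{Σ_w Σ_{σ ↦ w} κ_σ}`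
  multiply to `1` for any `κ : Σ → ℕ` and any map `g : Σ → W` (the (ord) re-indexing).
* `eq_one_of_sq_eq_one` — the torsion-free step of (ψ1), (ψ2), (ψ4): `x ^ 2 = 1 → x = 1`.
* `eq_one_of_pow_prime_pow_eq_one_of_sq_eq_one` — S8 / H.1 / H.2: a `p`-power root of
  unity with square `1` is `1` when `p` is odd.
* `anticyclotomic_trivial_on_fixed` — H.1: a character of `p`-power order with
  `ν ∘ c = ν⁻¹` is trivial on the `c`-fixed points.
* `char_shift` — the L-value row of the dictionary §G.2 as an identity in a commutative
  group with an endomorphism `c`: `λ · c λ = N⁻¹` and `c ν = ν⁻¹` give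
  `λ⁻¹ · ν = c (λ · ν⁻¹) · N`.
* `mu_eq_top_iff`, `local_mu_lt_top`, `mu_sum_lt_top` — S1/S4: `μ = ⊤` iff every value is
  `0`; the local invariant of a non-trivial character is finite; a finite sum of finite
  terms is finite.
* `mu_twist_invariant` — [A-3]: an infimum over test functions is unchanged by a bijection
  of the test functions.
* `zeros_finite_and_card_le_natDegree` — S5: `f = c · P · U` with `c ≠ 0`, `U` non-vanishing on
  `D`, `P ≠ 0`, and `ι` injective into `D` ⇒ the zero set of `f ∘ ι` is finite with at most
  `natDegree P` elements.
* `factor_ne_zero_of_prod_ne_zero`, `one_sub_ne_zero_of_norm_ne_one` — S6.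
* `prod_zero_set_subset_biUnion`, `card_biUnion_le'` — S7: the exceptional set of a product
  is contained in the union of the exceptional sets, whose size is at most the sum.
-/

namespace Summit.Ventures.HodgeRepro2.T5PropGArithmetic

open Finset

section Parity

variable {Sg W : Type*} [Fintype Sg] [Fintype W] [DecidableEq W]

/-- S3 (the (ord) re-indexing): `Σ_σ κ_σ = Σ_w Σ_{σ : g σ = w} κ_σ` for any map `g : Σ → W`. -/
theorem sum_eq_sum_fiberwise (κ : Sg → ℕ) (g : Sg → W) :
    ∑ σ, κ σ = ∑ w, ∑ σ ∈ univ.filter (fun σ => g σ = w), κ σ :=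
  (Finset.sum_fiberwise univ g κ).symm

/-- S3: the product of the archimedean sign `(-1)^{Σ_σ κ_σ}` and the `p`-adic sign
`(-1)^{Σ_w κ(w)}`, `κ(w) = Σ_{σ ↦ w} κ_σ`, is `1` — each `σ ∈ Σ` induces exactly one
place `w`, so the two exponents are equal and the product is `(-1)^{2 Σ κ} = 1`. -/
theorem parity_reindex (κ : Sg → ℕ) (g : Sg → W) :
    ((-1 : ℤ) ^ (∑ σ, κ σ)) *
      ((-1 : ℤ) ^ (∑ w, ∑ σ ∈ univ.filter (fun σ => g σ = w), κ σ)) = 1 := by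
  rw [← sum_eq_sum_fiberwise κ g, ← pow_add, ← two_mul, pow_mul]
  simp

end Parity

section Torsion

/-- The torsion-free step used in (ψ1), (ψ2), (ψ4) and H.1: in a torsion-free monoid
(`Γ^-` is a free `ℤ_p`-module), `x ^ 2 = 1` forces `x = 1`. -/
theorem eq_one_of_sq_eq_one {M : Type*} [Monoid M] [IsMulTorsionFree M] {x : M}
    (h : x ^ 2 = 1) : x = 1 :=
  pow_left_injective (M := M) (n := 2) two_ne_zero (by simpa using h)

/-- S8 / H.1 / H.2: if `ζ ^ (p ^ n) = 1` and `ζ ^ 2 = 1` with `p` odd, then `ζ = 1`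
(the order of `ζ` divides `gcd (2, p ^ n) = 1`). -/
theorem eq_one_of_pow_prime_pow_eq_one_of_sq_eq_one {M : Type*} [Monoid M] {ζ : M}
    {p n : ℕ} (hp : Odd p) (h₁ : ζ ^ (p ^ n) = 1) (h₂ : ζ ^ 2 = 1) : ζ = 1 := by
  have hd₁ : orderOf ζ ∣ p ^ n := orderOf_dvd_iff_pow_eq_one.mpr h₁
  have hd₂ : orderOf ζ ∣ 2 := orderOf_dvd_iff_pow_eq_one.mpr h₂
  have hcop : Nat.Coprime 2 (p ^ n) := (Nat.coprime_two_left.mpr hp).pow_right n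
  have h1 : orderOf ζ ∣ 1 := by
    have := Nat.dvd_gcd hd₂ hd₁
    rwa [hcop] at this
  exact orderOf_eq_one_iff.mp (Nat.dvd_one.mp h1)

/-- H.1: a character `ν` of `p`-power order (`p` odd) with `ν (c g) = (ν g)⁻¹` is trivial on
every `c`-fixed `g` (on `𝔸_F^×` the anticyclotomic twist `ν̃` is trivial). -/
theorem anticyclotomic_trivial_on_fixed {G M : Type*} [Group G] [CommGroup M]
    (ν : G →* M) (c : G → G) (hc : ∀ g, ν (c g) = (ν g)⁻¹) {p n : ℕ} (hp : Odd p)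
    (hord : ∀ g, ν g ^ (p ^ n) = 1) {g : G} (hg : c g = g) : ν g = 1 := by
  have hsq : ν g ^ 2 = 1 := by
    have hinv : ν g = (ν g)⁻¹ := by
      have := hc g
      rwa [hg] at this
    have h2 : ν g * ν g = 1 := by
      nth_rewrite 2 [hinv]
      exact mul_inv_cancel _
    rw [pow_two]
    exact h2
  exact eq_one_of_pow_prime_pow_eq_one_of_sq_eq_one hp (hord g) hsq

end Torsion

section CharacterShift

/-- §G.2, L-value row: in the commutative group of Hecke characters with the involution `c`
(`λ ↦ λ ∘ c`) and the norm character `N = |·|_K`, the self-duality `λ · c λ = N⁻¹` and the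
anticyclotomic condition `c ν = ν⁻¹` give `λ⁻¹ · ν = c (λ · ν⁻¹) · N`, i.e.
`L(s, λ⁻¹ ν) = L(s + 1, λ ν⁻¹)` once `L(s, μ^c) = L(s, μ)` and `L(s, μ N) = L(s + 1, μ)` are
granted. -/
theorem char_shift {X : Type*} [CommGroup X] (c : X →* X) (lam ν N : X)
    (hself : lam * c lam = N⁻¹) (hanti : c ν = ν⁻¹) :
    lam⁻¹ * ν = c (lam * ν⁻¹) * N := by
  have hlam : lam⁻¹ = c lam * N :=
    mul_eq_one_iff_inv_eq.mp (by rw [← mul_assoc, hself, inv_mul_cancel])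
  rw [map_mul, map_inv, hanti, inv_inv, hlam, mul_right_comm]

end CharacterShift

section Mu

/-- S1: the `μ`-invariant `μ(φ) = inf_U v_p(φ(U))` (infimum over the opens) is `⊤` iff
`φ(U) = 0` for every `U`, i.e. iff `φ = 0`; here `v` is any function with `v a = ⊤ ↔ a = 0`. -/
theorem mu_eq_top_iff {U R : Type*} [Zero R] (v : R → ℕ∞) (hv : ∀ a, v a = ⊤ ↔ a = 0)
    (φ : U → R) : (⨅ u, v (φ u)) = ⊤ ↔ ∀ u, φ u = 0 := by
  rw [iInf_eq_top]
  exact forall_congr' fun u => hv (φ u)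

/-- S4: the local invariant `μ_p(χ_v) = inf_x v_p(χ_v(x) − 1)` of a NON-trivial character
`χ_v` is finite: some `χ_v(x) ≠ 1`, and `v(χ_v(x) − 1) ≠ ⊤` there. -/
theorem local_mu_lt_top {K R : Type*} [Ring R] (v : R → ℕ∞) (hv : ∀ a, v a = ⊤ ↔ a = 0)
    (χ : K → R) (hχ : ∃ x, χ x ≠ 1) : (⨅ x, v (χ x - 1)) < ⊤ := by
  obtain ⟨x, hx⟩ := hχ
  have hne : v (χ x - 1) ≠ ⊤ := by
    rw [Ne, hv, sub_eq_zero]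
    exact hx
  exact lt_of_le_of_lt (iInf_le _ x) (lt_top_iff_ne_top.mpr hne)

/-- S4: `μ^- = Σ_{v | 𝒞^-} μ_p(χ_v)` is finite when every local term is finite. -/
theorem mu_sum_lt_top {ι : Type*} (s : Finset ι) (μ : ι → ℕ∞) (h : ∀ v ∈ s, μ v < ⊤) :
    (∑ v ∈ s, μ v) < ⊤ :=
  WithTop.sum_lt_top.mpr h

/-- [A-3]: an infimum over the test functions is unchanged when the test functions are
permuted by a bijection (`φ ↦ φ · ν̃` for a unit-valued `ν̃`): `μ(ν̃ · m) = μ(m)`. -/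
theorem mu_twist_invariant {T : Type*} (g : T → ℕ∞) (τ : T ≃ T) :
    (⨅ φ, g (τ φ)) = ⨅ φ, g φ :=
  τ.iInf_comp

end Mu

section Zeros

open Polynomial

/-- S5: if `f x = c * P.eval x * U x` with `c ≠ 0`, `U` non-vanishing on `D`, `P ≠ 0`, and
`ι : Ξ → K` is injective with values in `D`, then `{ν | f (ι ν) = 0}` is finite and has at
most `natDegree P` elements (the zeros of a distinguished polynomial on the open disc;
`ν ↦ ν(γ₀) − 1` is the injection). -/
theorem zeros_finite_and_card_le_natDegree {K Ξ : Type*} [Field K] [DecidableEq K] (P : K[X])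
    (hP : P ≠ 0)
    (c : K) (hc : c ≠ 0) (U : K → K) (D : Set K) (hU : ∀ x ∈ D, U x ≠ 0)
    (ι : Ξ → K) (hι : Function.Injective ι) (hD : ∀ ν, ι ν ∈ D) :
    {ν | c * P.eval (ι ν) * U (ι ν) = 0}.Finite ∧
      {ν | c * P.eval (ι ν) * U (ι ν) = 0}.ncard ≤ P.natDegree := by
  set S : Set Ξ := {ν | c * P.eval (ι ν) * U (ι ν) = 0} with hS
  have hmem : ∀ ν ∈ S, ι ν ∈ (P.roots.toFinset : Set K) := by
    intro ν hν
    have h0 : c * P.eval (ι ν) * U (ι ν) = 0 := hν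
    have hev : P.eval (ι ν) = 0 := by
      rcases mul_eq_zero.mp h0 with h | h
      · rcases mul_eq_zero.mp h with h' | h'
        · exact absurd h' hc
        · exact h'
      · exact absurd h (hU _ (hD ν))
    simpa [Polynomial.mem_roots hP] using hev
  have hfin : S.Finite := by
    refine Set.Finite.of_finite_image ?_ hι.injOn
    exact (P.roots.toFinset.finite_toSet).subset (by
      rintro _ ⟨ν, hν, rfl⟩
      exact hmem ν hν)
  refine ⟨hfin, ?_⟩
  calc S.ncard ≤ ((P.roots.toFinset : Finset K) : Set K).ncard :=
        Set.ncard_le_ncard_of_injOn ι hmem hι.injOn (Finset.finite_toSet _)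
    _ = P.roots.toFinset.card := Set.ncard_coe_finset _
    _ ≤ Multiset.card P.roots := Multiset.toFinset_card_le _
    _ ≤ P.natDegree := Polynomial.card_roots' P

end Zeros

section Euler

/-- S6: a non-zero finite product has every factor non-zero (the right side of the
interpolation formula (1.1) is a finite product, so `L^{(p𝒞)}(0, χ) ≠ 0`). -/
theorem factor_ne_zero_of_prod_ne_zero {ι R : Type*} [CommMonoidWithZero R] [NoZeroDivisors R]
    [Nontrivial R] (s : Finset ι) (f : ι → R) (h : (∏ i ∈ s, f i) ≠ 0) :
    ∀ i ∈ s, f i ≠ 0 :=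
  Finset.prod_ne_zero_iff.mp h

/-- S6: an unramified Euler factor `(1 − χ_w(ϖ_w))⁻¹` is a finite non-zero number as soon as
`|χ_w(ϖ_w)| ≠ 1` (here `q_w^{−1/2}`): `1 − a ≠ 0` when `‖a‖ ≠ 1`. -/
theorem one_sub_ne_zero_of_norm_ne_one {R : Type*} [NormedRing R] [NormOneClass R] {a : R}
    (h : ‖a‖ ≠ 1) : 1 - a ≠ 0 := by
  intro h0
  apply h
  rw [sub_eq_zero] at h0
  rw [← h0, norm_one]

end Euler

section Union

variable {ι Ξ R : Type*} [DecidableEq Ξ] [CommMonoidWithZero R] [NoZeroDivisors R]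
  [Nontrivial R]

/-- S7: if `L i ν ≠ 0` for every `ν` outside the finite set `Z i`, then the zero set of the
product `∏_{i ∈ I} L i ν` is contained in `⋃_{i ∈ I} Z i`. -/
theorem prod_zero_set_subset_biUnion (I : Finset ι) (Z : ι → Finset Ξ) (L : ι → Ξ → R)
    (hL : ∀ i ∈ I, ∀ ν, ν ∉ Z i → L i ν ≠ 0) :
    {ν | (∏ i ∈ I, L i ν) = 0} ⊆ (I.biUnion Z : Set Ξ) := by
  intro ν hν
  have h0 : (∏ i ∈ I, L i ν) = 0 := hν
  obtain ⟨i, hi, hzero⟩ := Finset.prod_eq_zero_iff.mp h0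
  have hmem : ν ∈ Z i := by
    by_contra hcon
    exact hL i hi ν hcon hzero
  simpa using ⟨i, hi, hmem⟩

/-- S7: the union of the exceptional sets has at most `Σ_i |Z i|` elements. -/
theorem card_biUnion_le' (I : Finset ι) (Z : ι → Finset Ξ) :
    (I.biUnion Z).card ≤ ∑ i ∈ I, (Z i).card :=
  Finset.card_biUnion_le

/-- S7, assembled: outside the finite set `I.biUnion Z` (of size `≤ Σ_i |Z i|`) every product
`∏_{i ∈ I} L i ν` is non-zero. -/
theorem prod_ne_zero_of_not_mem_biUnion (I : Finset ι) (Z : ι → Finset Ξ) (L : ι → Ξ → R)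
    (hL : ∀ i ∈ I, ∀ ν, ν ∉ Z i → L i ν ≠ 0) (ν : Ξ) (hν : ν ∉ I.biUnion Z) :
    (∏ i ∈ I, L i ν) ≠ 0 := by
  intro h0
  exact hν (prod_zero_set_subset_biUnion I Z L hL h0)

end Union

end Summit.Ventures.HodgeRepro2.T5PropGArithmetic
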